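import Literature.NumberTheory.GaloisRepresentations.LocalWeilDatumValuation
import Literature.NumberTheory.GaloisRepresentations.LocalWeilDatumUnramified
import HarnessLib

/-!
# The Weil datum of a non-archimedean local field, V: the abstract inertia degree is the residue degree

For a finite separable `K ⊆ F̄` over a non-archimedean local field `F`, Neukirch's abstract
inertia degree `f_U` of the Weil subgroup `U = W_F ∩ G_K` — the least positive degree (power of
the arithmetic Frobenius on the residue field of `F̄`) of an element of `U`
(`AbstractCFT.inertiaDeg (degHom F) U`) — equals the residue degree
`f = [O_K/𝔓_K : 𝓀_F]` (`Ideal.inertiaDeg' 𝓂[F] 𝔓_K`):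
`LocalWeilDatum.inertiaDeg_fieldSubgroup_eq`.

* `f ∣ deg w` for `w ∈ U` (`inertiaDeg_dvd_deg_of_mem_fieldSubgroup`): `w` of degree `m ≥ 0`
  fixes `O_K`, so `x ^ (q ^ m) = x` on the finite field `O_K/𝔓_K` of `q ^ f` elements, whence
  `q ^ f - 1 ∣ q ^ m - 1` (`FiniteField.forall_pow_eq_one_iff`) and `f ∣ m`;
* some `w ∈ U` has degree exactly `f` (`exists_mem_fieldSubgroup_deg_eq_inertiaDeg`): the
  automorphism `x ↦ x ^ (q ^ f)` of the residue field `\bar ℤ_F / 𝔓` fixes the residues of the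
  `G_K`-invariants (these are `p`-power roots of elements of `O_K`,
  `pow_residueFieldCard_pow_inertiaDeg_eq_of_forall_galFixing`), hence is induced by some
  `τ ∈ G_K` (`exists_mem_forall_mk_smul_eq`, the profinite lifting lemma of `WeilGroupDensityProofs`).

This is the input `f_U` of the henselian-valuation axiom `v(N_{K|F} Kˣ) = f_U ℤ` of the local
Weil datum (Neukirch IV (4.6) (ii)), assembled in the sequel.

## References

* J. Neukirch, *Algebraic Number Theory*, Ch. IV §4 (`d_K = (1/f_K) d`, `f_K = [Z : d(G_K)]`),
  Ch. V §1. [NeukirchANT1999]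
* J.-P. Serre, *Local Fields*, Ch. I §7 Prop. 20–22, Ch. II §2–§3. [SerreLocalFields1979]
-/

noncomputable section

open Field IsNonarchimedeanLocalField ValuativeRel
open scoped Pointwise Valued

namespace Literature.NumberTheory.GaloisRepresentations

namespace LocalWeilDatum

open AbstractCFT GaloisRepresentations.IsNonarchimedeanLocalField

section Degree

variable (F : Type*) [Field F] [ValuativeRel F] [TopologicalSpace F] [IsNonarchimedeanLocalField F]
variable (K : IntermediateField F (AlgebraicClosure F))

/-- **Elements of `W_F ∩ G_K` of degree `m ≥ 0` act trivially on the residues of `O_K`**: they act on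
`\bar ℤ_F / 𝔓` as `x ↦ x ^ (q ^ m)` and fix `O_K` pointwise, so `ā ^ (q ^ m) = ā` in `O_K / 𝔓_K`.
[cite: NeukirchANT1999, Ch. IV §4 (`d_K`); SerreLocalFields1979, Ch. I §7 Prop. 21] -/
theorem mk_pow_eq_mk_of_mem_fieldSubgroup {w : WeilGroup F} (hw : w ∈ fieldSubgroup F K) {m : ℕ}
    (hm : WeilGroup.deg w = m) (a : integralClosure 𝒪[F] K) :
    Ideal.Quotient.mk (primeOf F K) a ^ residueFieldCard F ^ m = Ideal.Quotient.mk (primeOf F K) a := by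
  have hσ : IsFrobPow (WeilGroup.toAbsGalois F w) (m : ℤ) :=
    (WeilGroup.deg_eq_iff IsFrobPow.mul_holds IsFrobPow.unique_holds).mp hm
  have hfix : WeilGroup.toAbsGalois F w • K.integralClosureToAbsIntegers 𝒪[F] a =
      K.integralClosureToAbsIntegers 𝒪[F] a := by
    apply Subtype.ext
    rw [integralClosure.coe_smul]
    exact (mem_fieldSubgroup_iff F).mp hw _ (a : K).2
  have h1 := (isFrobPow_natCast_iff.mp hσ) (K.integralClosureToAbsIntegers 𝒪[F] a)
  rw [hfix] at h1
  have h2 : a - a ^ residueFieldCard F ^ m ∈ primeOf F K := by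
    rw [Ideal.mem_comap, map_sub, map_pow]
    exact h1
  rw [eq_comm, ← map_pow, Ideal.Quotient.eq]
  exact h2

/-- **`f ∣ deg w` for `w ∈ W_F ∩ G_K`**: the residue field `O_K / 𝔓_K` has `q ^ f` elements and is
fixed by `x ↦ x ^ (q ^ |deg w|)`, so `q ^ f - 1 ∣ q ^ |deg w| - 1`.
[cite: NeukirchANT1999, Ch. IV §4 (`f_K`); SerreLocalFields1979, Ch. I §7 Prop. 21–22] -/
theorem inertiaDeg_dvd_deg_of_mem_fieldSubgroup [FiniteDimensional F K] {w : WeilGroup F} (hw : w ∈ fieldSubgroup F K) :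
    (Ideal.inertiaDeg' 𝓂[F] (primeOf F K) : ℤ) ∣ WeilGroup.deg w := by
  classical
  have key : ∀ (w : WeilGroup F), w ∈ fieldSubgroup F K → ∀ m : ℕ, WeilGroup.deg w = m →
      Ideal.inertiaDeg' 𝓂[F] (primeOf F K) ∣ m := by
    intro w hw m hm
    haveI := isMaximal_primeOf F K
    letI := Ideal.Quotient.field (primeOf F K)
    haveI := finite_quotient_primeOf F K
    letI := Fintype.ofFinite (integralClosure 𝒪[F] K ⧸ primeOf F K)
    have hq : 2 ≤ residueFieldCard F := one_lt_residueFieldCard F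
    have hcard : Fintype.card (integralClosure 𝒪[F] K ⧸ primeOf F K) =
        residueFieldCard F ^ Ideal.inertiaDeg' 𝓂[F] (primeOf F K) := by
      rw [← Nat.card_eq_fintype_card, card_quotient_primeOf]
    have hQ : 1 ≤ residueFieldCard F ^ m := Nat.one_le_pow _ _ (by omega)
    have hall : ∀ x : (integralClosure 𝒪[F] K ⧸ primeOf F K)ˣ, x ^ (residueFieldCard F ^ m - 1) = 1 := by
      intro x
      obtain ⟨a, ha⟩ := Ideal.Quotient.mk_surjective (x : integralClosure 𝒪[F] K ⧸ primeOf F K)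
      have h1 := mk_pow_eq_mk_of_mem_fieldSubgroup F K hw hm a
      rw [ha] at h1
      apply Units.ext
      have h2 : (x : integralClosure 𝒪[F] K ⧸ primeOf F K) ^ (residueFieldCard F ^ m - 1) * x = 1 * x := by
        rw [← pow_succ, Nat.sub_add_cancel hQ, h1, one_mul]
      push_cast
      exact mul_right_cancel₀ (Units.ne_zero x) h2
    have hdvd := (FiniteField.forall_pow_eq_one_iff (integralClosure 𝒪[F] K ⧸ primeOf F K) _).mp hall
    rw [hcard, pow_sub_one_dvd_pow_sub_one_iff hq] at hdvd
    exact hdvd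
  rcases Int.eq_nat_or_neg (WeilGroup.deg w) with ⟨m, hm | hm⟩
  · rw [hm, Int.natCast_dvd_natCast]
    exact key w hw m hm
  · have hm' : WeilGroup.deg w⁻¹ = m := by
      rw [WeilGroup.deg_inv IsFrobPow.mul_holds IsFrobPow.unique_holds, hm, neg_neg]
    rw [hm, dvd_neg, Int.natCast_dvd_natCast]
    exact key w⁻¹ ((fieldSubgroup F K).inv_mem hw) m hm'

/-- **Residues of `G_K`-invariants lie in `𝔽_{q^f}`**: for `K ⊆ F^sep` finite and an absolute
integer `a` fixed by `G_K`, `ā ^ (q ^ f) = ā` in `\bar ℤ_F / 𝔓` (`f` the residue degree of `K`):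
some `p`-power `a ^ (p ^ r)` (`p` the exponential characteristic) lies in `F^sep`, hence in `K` by
Galois theory, so in `O_K`, whose residues form the field with `q ^ f` elements; and `p`-th roots are
unique in characteristic `p`. [cite: SerreLocalFields1979, Ch. I §7 Prop. 21 (residue extension)] -/
theorem pow_residueFieldCard_pow_inertiaDeg_eq_of_forall_galFixing [FiniteDimensional F K] (hKs : K ≤ sepClosure F)
    (a : absIntegers 𝒪[F] F) (ha : ∀ τ ∈ galFixing F K, τ • a = a) :
    haveI : (absMaximalIdeal F).IsMaximal := absMaximalIdeal_isMaximal_holds F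
    Ideal.Quotient.mk (absMaximalIdeal F) a ^ residueFieldCard F ^ Ideal.inertiaDeg' 𝓂[F] (primeOf F K) =
      Ideal.Quotient.mk (absMaximalIdeal F) a := by
  classical
  haveI h𝔓 : (absMaximalIdeal F).IsMaximal := absMaximalIdeal_isMaximal_holds F
  letI := Ideal.Quotient.field (absMaximalIdeal F)
  set f := Ideal.inertiaDeg' 𝓂[F] (primeOf F K) with hf_def
  -- the finite field `O_K / 𝔓_K` with `q ^ f` elements
  haveI := isMaximal_primeOf F K
  haveI := finite_quotient_primeOf F K
  letI := Fintype.ofFinite (integralClosure 𝒪[F] K ⧸ primeOf F K)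
  have hcard : Fintype.card (integralClosure 𝒪[F] K ⧸ primeOf F K) = residueFieldCard F ^ f := by
    rw [← Nat.card_eq_fintype_card, card_quotient_primeOf]
  -- residues of elements of `O_K` satisfy `x ^ (q ^ f) = x` (in `\bar ℤ_F / 𝔓`)
  have hOK : ∀ c : integralClosure 𝒪[F] K,
      Ideal.Quotient.mk (absMaximalIdeal F) (K.integralClosureToAbsIntegers 𝒪[F] c) ^ residueFieldCard F ^ f =
        Ideal.Quotient.mk (absMaximalIdeal F) (K.integralClosureToAbsIntegers 𝒪[F] c) := by
    intro c
    letI := Ideal.Quotient.field (primeOf F K)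
    have h1 : c ^ residueFieldCard F ^ f - c ∈ primeOf F K := by
      rw [← Ideal.Quotient.eq, map_pow, ← hcard]
      exact FiniteField.pow_card _
    have h2 := Ideal.mem_comap.mp h1
    rw [map_sub, map_pow] at h2
    rw [← map_pow, Ideal.Quotient.eq]
    exact h2
  -- a `p`-power of `a` lies in `K`
  have haint : IsIntegral 𝒪[F] (a : AlgebraicClosure F) := a.2
  obtain ⟨p, hp⟩ := ExpChar.exists F
  rcases hp with _ | ⟨hprime⟩
  · -- characteristic `0`: `F̄ = F^sep`, `a ∈ O_K` itself
    haveI : ExpChar (SepClosure F) 1 := expChar_of_injective_algebraMap (algebraMap F (SepClosure F)).injective 1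
    haveI : IsPurelyInseparable (SepClosure F) (AlgebraicClosure F) := separableClosure.isPurelyInseparable F _
    obtain ⟨r, b, hb⟩ := IsPurelyInseparable.pow_mem (SepClosure F) 1 (a : AlgebraicClosure F)
    rw [one_pow, pow_one] at hb
    have hb' : ((b : SepClosure F) : AlgebraicClosure F) = a := hb
    have hbK : ((b : SepClosure F) : AlgebraicClosure F) ∈ K := by
      apply coe_mem_of_forall_galFixing_smul F hKs
      intro σ hσ
      rw [hb', ← integralClosure.coe_smul, ha σ hσ]
    have hcint : IsIntegral 𝒪[F] (⟨_, hbK⟩ : K) := by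
      refine (isIntegral_algHom_iff (K.val.restrictScalars 𝒪[F]) (fun _ _ h => Subtype.ext h)).mp ?_
      show IsIntegral 𝒪[F] ((b : SepClosure F) : AlgebraicClosure F)
      rw [hb']
      exact haint
    have hφc : K.integralClosureToAbsIntegers 𝒪[F] ⟨⟨_, hbK⟩, hcint⟩ = a := Subtype.ext hb'
    have := hOK ⟨⟨_, hbK⟩, hcint⟩
    rwa [hφc] at this
  · -- characteristic `p`
    haveI : Fact p.Prime := ⟨hprime⟩
    haveI : ExpChar (SepClosure F) p := expChar_of_injective_algebraMap (algebraMap F (SepClosure F)).injective p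
    haveI : IsPurelyInseparable (SepClosure F) (AlgebraicClosure F) := separableClosure.isPurelyInseparable F _
    obtain ⟨r, b, hb⟩ := IsPurelyInseparable.pow_mem (SepClosure F) p (a : AlgebraicClosure F)
    have hb' : ((b : SepClosure F) : AlgebraicClosure F) = (a : AlgebraicClosure F) ^ p ^ r := hb
    have hbK : ((b : SepClosure F) : AlgebraicClosure F) ∈ K := by
      apply coe_mem_of_forall_galFixing_smul F hKs
      intro σ hσ
      rw [hb', smul_pow', ← integralClosure.coe_smul, ha σ hσ]
    have hcint : IsIntegral 𝒪[F] (⟨_, hbK⟩ : K) := by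
      refine (isIntegral_algHom_iff (K.val.restrictScalars 𝒪[F]) (fun _ _ h => Subtype.ext h)).mp ?_
      show IsIntegral 𝒪[F] ((b : SepClosure F) : AlgebraicClosure F)
      rw [hb']
      exact haint.pow _
    have hφc : K.integralClosureToAbsIntegers 𝒪[F] ⟨⟨_, hbK⟩, hcint⟩ = a ^ p ^ r := Subtype.ext hb'
    have h3 := hOK ⟨⟨_, hbK⟩, hcint⟩
    rw [hφc, map_pow] at h3
    -- `κ` has characteristic `p`: `(p : F) = 0`, hence `(p : κ) = 0`
    haveI : Nontrivial (absIntegers 𝒪[F] F ⧸ absMaximalIdeal F) := inferInstance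
    haveI : CharP (absIntegers 𝒪[F] F ⧸ absMaximalIdeal F) p := by
      refine (CharP.charP_iff_prime_eq_zero hprime).mpr ?_
      have hpO : (p : 𝒪[F]) = 0 := Subtype.ext (by simp)
      rw [← map_natCast (Ideal.Quotient.mk (absMaximalIdeal F)), ← map_natCast (algebraMap 𝒪[F] (absIntegers 𝒪[F] F)),
        hpO, map_zero, map_zero]
    -- `(ā ^ (q^f) - ā) ^ (p ^ r) = 0`
    set x := Ideal.Quotient.mk (absMaximalIdeal F) a with hx
    have h4 : (x ^ residueFieldCard F ^ f - x) ^ p ^ r = 0 := by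
      rw [sub_pow_char_pow, ← pow_mul, mul_comm, pow_mul, h3, sub_self]
    have h5 := pow_eq_zero_iff (pow_ne_zero r hprime.ne_zero) |>.mp h4
    exact sub_eq_zero.mp h5

/-- **Some element of `W_F ∩ G_K` has degree exactly `f`** (`K ⊆ F^sep` finite): the automorphism
`x ↦ x ^ (q ^ f)` of the perfect field `\bar ℤ_F / 𝔓` fixes the residues of the `G_K`-invariants,
hence is induced by some `τ ∈ G_K` (profinite lifting, `exists_mem_forall_mk_smul_eq`), which is then a
Frobenius power of exponent `f`, i.e. an element of `W_F` of degree `f`.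
[cite: NeukirchANT1999, Ch. IV §4 (`φ_K`, (4.1)); SerreLocalFields1979, Ch. I §7 Prop. 20–22] -/
theorem exists_mem_fieldSubgroup_deg_eq_inertiaDeg [FiniteDimensional F K] (hKs : K ≤ sepClosure F) :
    ∃ w ∈ fieldSubgroup F K, WeilGroup.deg w = Ideal.inertiaDeg' 𝓂[F] (primeOf F K) := by
  classical
  set f := Ideal.inertiaDeg' 𝓂[F] (primeOf F K) with hf_def
  haveI h𝔓 : (absMaximalIdeal F).IsMaximal := absMaximalIdeal_isMaximal_holds F
  letI := Ideal.Quotient.field (absMaximalIdeal F)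
  haveI : ((absMaximalIdeal F).under 𝒪[F]).IsMaximal := Ideal.IsMaximal.under 𝒪[F] _
  letI := Ideal.Quotient.field ((absMaximalIdeal F).under 𝒪[F])
  haveI : Finite (𝒪[F] ⧸ (absMaximalIdeal F).under 𝒪[F]) := Nat.finite_of_card_ne_zero (by
    rw [card_quotient_under_absMaximalIdeal_holds F]
    exact residueFieldCard_ne_zero F)
  letI : Fintype (𝒪[F] ⧸ (absMaximalIdeal F).under 𝒪[F]) := Fintype.ofFinite _
  have hq : Fintype.card (𝒪[F] ⧸ (absMaximalIdeal F).under 𝒪[F]) = residueFieldCard F := by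
    rw [Fintype.card_eq_nat_card, card_quotient_under_absMaximalIdeal_holds F]
  obtain ⟨p, hchar⟩ := CharP.exists (𝒪[F] ⧸ (absMaximalIdeal F).under 𝒪[F])
  obtain ⟨f₀, hp, hf₀⟩ := FiniteField.card (𝒪[F] ⧸ (absMaximalIdeal F).under 𝒪[F]) p
  haveI : CharP (absIntegers 𝒪[F] F ⧸ absMaximalIdeal F) p :=
    charP_of_injective_algebraMap
      (algebraMap (𝒪[F] ⧸ (absMaximalIdeal F).under 𝒪[F]) _).injective p
  haveI : ExpChar (absIntegers 𝒪[F] F ⧸ absMaximalIdeal F) p := .prime hp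
  haveI : Algebra.IsAlgebraic (𝒪[F] ⧸ (absMaximalIdeal F).under 𝒪[F])
    (absIntegers 𝒪[F] F ⧸ absMaximalIdeal F) := Algebra.IsIntegral.isAlgebraic
  haveI : PerfectField (absIntegers 𝒪[F] F ⧸ absMaximalIdeal F) :=
    Algebra.IsAlgebraic.perfectField (𝒪[F] ⧸ (absMaximalIdeal F).under 𝒪[F])
  let Φ : (absIntegers 𝒪[F] F ⧸ absMaximalIdeal F) ≃+* (absIntegers 𝒪[F] F ⧸ absMaximalIdeal F) :=
    iterateFrobeniusEquiv _ p (f₀ * f)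
  have hΦ : ∀ x, Φ x = x ^ residueFieldCard F ^ f := fun x => by
    change iterateFrobenius _ p (f₀ * f) x = _
    rw [iterateFrobenius_def, pow_mul, ← hf₀, hq]
  have hβ : ∀ a : absIntegers 𝒪[F] F, (∀ τ ∈ galFixing F K, τ • a = a) →
      Φ (Ideal.Quotient.mk _ a) = Ideal.Quotient.mk _ a := by
    intro a ha
    rw [hΦ]
    exact pow_residueFieldCard_pow_inertiaDeg_eq_of_forall_galFixing F K hKs a ha
  obtain ⟨τ, hτK, hτ⟩ := exists_mem_forall_mk_smul_eq F (galFixing F K) (isClosed_galFixing F K) Φ hβ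
  have hfrob : IsFrobPow τ (f : ℤ) := by
    rw [isFrobPow_natCast_iff]
    intro x
    rw [← Ideal.Quotient.eq, map_pow, hτ, hΦ]
  refine ⟨WeilGroup.mk τ ⟨f, hfrob⟩, ?_, ?_⟩
  · rw [← toAbsGalois_mem_galFixing_iff, WeilGroup.toAbsGalois_mk]
    exact hτK
  · exact (WeilGroup.deg_eq_iff IsFrobPow.mul_holds IsFrobPow.unique_holds).mpr
      (by rw [WeilGroup.toAbsGalois_mk]; exact hfrob)

/-- **The abstract inertia degree is the residue degree**: for `K ⊆ F^sep` finite,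
`f_{W_F ∩ G_K} = inf {deg w > 0 : w ∈ W_F ∩ G_K} = f = [O_K/𝔓_K : 𝓀_F]`.
[cite: NeukirchANT1999, Ch. IV §4 (`f_K`, `d_K = (1/f_K) d`); Ch. V §1] -/
theorem inertiaDeg_fieldSubgroup_eq [FiniteDimensional F K] (hKs : K ≤ sepClosure F) :
    AbstractCFT.inertiaDeg (degHom F) (fieldSubgroup F K) = Ideal.inertiaDeg' 𝓂[F] (primeOf F K) := by
  haveI := primeOf_liesOver F K
  haveI := module_finite_integralClosure F K
  have hf : 0 < Ideal.inertiaDeg' 𝓂[F] (primeOf F K) := Ideal.inertiaDeg'_pos 𝓂[F] (primeOf F K)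
  obtain ⟨w, hw, hdeg⟩ := exists_mem_fieldSubgroup_deg_eq_inertiaDeg F K hKs
  have hmem : Ideal.inertiaDeg' 𝓂[F] (primeOf F K) ∈
      {n : ℕ | 0 < n ∧ ∃ σ ∈ fieldSubgroup F K, AbstractCFT.degZ (degHom F) σ = n} :=
    ⟨hf, w, hw, by rw [degZ_degHom, hdeg]⟩
  unfold AbstractCFT.inertiaDeg
  apply le_antisymm (Nat.sInf_le hmem)
  refine le_csInf ⟨_, hmem⟩ ?_
  rintro n ⟨hn, σ, hσ, hσn⟩
  rw [degZ_degHom] at hσn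
  have hdvd := inertiaDeg_dvd_deg_of_mem_fieldSubgroup F K hσ
  rw [hσn, Int.natCast_dvd_natCast] at hdvd
  exact Nat.le_of_dvd hn hdvd

end Degree

end LocalWeilDatum

end Literature.NumberTheory.GaloisRepresentations
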